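import Summits.BirchSwinnertonDyer.BirchSwinnertonDyer.Theses.KatoDescentPotSupersingular
import Summits.BirchSwinnertonDyer.BirchSwinnertonDyer.Theses.KatoDescentTamePotSupersingular
import Summits.BirchSwinnertonDyer.BirchSwinnertonDyer.Theorems.KatoDescentPotSupersingularReducibleUpperOfCoreInputs
import HarnessLib

/-!
# U₀-red from crux M's held CORE package, ROUTE-TYPED part: the items `WildUpperReducibleDefect` (K9, stmt-BirchSwinnertonDyer-19190) and
# `TameUpperReducibleDefect` (K8-t′, 19203) from `{nonempty_iwasawaH1Data, exists_isNewformOf, exists_memberHullZeta(Kummer)CoreInputs, Cassels, GZK,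
# modularity}`, and the typed glue terms over the routes' by-name aliases with `PublishedInputMemberHullZetaCore` (crux M's child 27962) in place of
# the count child 19707 (routes `KatoDescentPotSupersingular` / `KatoDescentTamePotSupersingular`; planner TARGET R283, question Q-U0red)

Seat `bsd-potss-rkm` g24 (prover; cell `bsd-potss`; `--supports …`; closes nothing by itself: the glue items with these types are the planner's to
file).  HONEST FRAMING: BSD is not proved by any of this; nothing is booked; theorems only (no definition, no named fact); every named fact is a
HYPOTHESIS except Poitou–Tate over `ℚ` (a tree theorem, discharged in the route-free companion `…ReducibleUpperOfCoreInputs`).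

## What

* **`wildUpperReducibleDefect_of_coreInputs`** / **`tameUpperReducibleDefect_of_coreInputs`** — the route decls from
  `nonempty_iwasawaH1Data → exists_isNewformOf → exists_memberHullZetaCoreInputs → bsdRHS_eq_of_isIsogenous → GZK → hasEntireLFunction_rat`
  (the items' defect hypotheses unused); `…_of_kummerCoreInputs` — the same from the PRINT-EXACT Kummer package p637289;
* **`wildUpperReducibleDefectOfCoreInputs_glue`** / **`tameUpperReducibleDefectOfCoreInputs_glue`** — typed over the routes' by-name aliases:
  `PublishedInputIwasawaH1DataRed → PublishedInputNewformKatoRed → PublishedInputMemberHullZetaCore → PublishedInputCasselsIsogenyRed →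
  PublishedInputRankEqAnalyticRankRed → PublishedInputEntireLFunctionRed → WildUpperReducibleDefect` (and the `…RedT` twin) — the glue terms of a U₀-red
  split re-keyed onto crux M's core child (ONE Kato input for M and U₀-red).

References: K. Kato, Astérisque 295 (2004), proof of Prop. 14.16 (pp. 244–245), §14.14 (p. 243), Lemma 14.18 (pp. 247–248) [Kato2004Asterisque];
J. W. S. Cassels, Arithmetic VIII (1965) [Cassels1965ArithmeticVIII]; R. L. Miller, LMS JCM 14 (2011) Def. 1.1 [Miller2011LMS].
-/

-- the summit and its single problem are both named `BirchSwinnertonDyer` (registry layout D-0017)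
set_option linter.dupNamespace false
set_option autoImplicit false

noncomputable section

open WeierstrassCurve Literature.NumberTheory.EllipticCurves Literature.NumberTheory.EllipticCurves.ModularForms
  Literature.NumberTheory.EllipticCurves.Kato2004 Literature.NumberTheory.GaloisCohomology
  Literature.NumberTheory.EllipticCurves.Rank1Residual Literature.NumberTheory.EllipticCurves.Rank1Residual.Typed
open Summit.BirchSwinnertonDyer.Rank1Residual Summit.BirchSwinnertonDyer.Rank1Residual.Additive

namespace Summit.BirchSwinnertonDyer.BirchSwinnertonDyer.Theorems.ReducibleUpperOfCoreInputs

/-! ## §3 The route items U₀-red (19190 / 19203) from the core fact — Poitou–Tate discharged -/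

/-- **The K9 item `WildUpperReducibleDefect` (stmt-BirchSwinnertonDyer-19190; type = the route decl verbatim) from ONE Kato input**:
`nonempty_iwasawaH1Data → exists_isNewformOf → exists_memberHullZetaCoreInputs → bsdRHS_eq_of_isIsogenous → GZK → hasEntireLFunction_rat →
WildUpperReducibleDefect` (the item's `ℤ/9`-member / odd-parity hypothesis is not used; Poitou–Tate over `ℚ` is a tree theorem).  Conditional on the
five named facts; the item is not closed by this theorem.
[cite: Kato2004Asterisque, proof of Prop. 14.16 (pp. 244–245), §14.14 (p. 243)] [cite: Cassels1965ArithmeticVIII] -/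
theorem wildUpperReducibleDefect_of_coreInputs (hne : Kato2004.nonempty_iwasawaH1Data)
    (hmod : exists_isNewformOf) (hin : Kato2004.exists_memberHullZetaCoreInputs)
    (hCassels : bsdRHS_eq_of_isIsogenous) (hGZK : rank_eq_analyticRank_of_analyticRank_le_one)
    (hmodL : hasEntireLFunction_rat) :
    Summit.BirchSwinnertonDyer.BirchSwinnertonDyer.Theses.KatoDescentPotSupersingular.WildUpperReducibleDefect :=
  fun W _ _ _ hr hO hred _ ↦
    missingUpperBoundAt_of_coreInputs hne hmod (poitouTate_selmerStructure_duality_of_conj (InputsPoitouTateSelmer.poitouTate_selmerStructure_duality_conj_holds ℚ)) hin hCassels hGZK hmodL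
      W 3 hO.1 hO.2.1.1 hO.2.1.2 hO.padicValRat_j_nonneg hred hr

/-- **The K8-t′ item `TameUpperReducibleDefect` (stmt-BirchSwinnertonDyer-19203; type = the route decl verbatim) from ONE Kato input**
(`ord_p j ≥ 0` from `ClassO5 := ⟨p ≠ 2, Addv, Or.inr SubTprime⟩`; the defect hypothesis is not used; Poitou–Tate discharged).
Conditional on the five named facts; the item is not closed by this theorem.
[cite: Kato2004Asterisque, proof of Prop. 14.16 (pp. 244–245), §14.14 (p. 243)] [cite: Cassels1965ArithmeticVIII] -/
theorem tameUpperReducibleDefect_of_coreInputs (hne : Kato2004.nonempty_iwasawaH1Data)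
    (hmod : exists_isNewformOf) (hin : Kato2004.exists_memberHullZetaCoreInputs)
    (hCassels : bsdRHS_eq_of_isIsogenous) (hGZK : rank_eq_analyticRank_of_analyticRank_le_one)
    (hmodL : hasEntireLFunction_rat) :
    Summit.BirchSwinnertonDyer.BirchSwinnertonDyer.Theses.KatoDescentTamePotSupersingular.TameUpperReducibleDefect :=
  fun W _ _ p _ hr hp hadd hT hred _ ↦
    have hO5 : ClassO5 W p := ⟨hp, hadd, Or.inr hT⟩
    missingUpperBoundAt_of_coreInputs hne hmod (poitouTate_selmerStructure_duality_of_conj (InputsPoitouTateSelmer.poitouTate_selmerStructure_duality_conj_holds ℚ)) hin hCassels hGZK hmodL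
      W p hp hadd.1 hadd.2 hO5.padicValRat_j_nonneg hred hr

/-- **The K9 item from the PRINT-EXACT (Kummer-form) package** `exists_memberHullZetaKummerCoreInputs` (p637289), through g22's kernel bridge
`exists_memberHullZetaCoreInputs_of_kummerCoreInputs`. [cite: Kato2004Asterisque, Prop. 14.16 (2) (p. 244) and Lemma 14.18 (pp. 247–248)] -/
theorem wildUpperReducibleDefect_of_kummerCoreInputs (hne : Kato2004.nonempty_iwasawaH1Data)
    (hmod : exists_isNewformOf) (hin : Kato2004.exists_memberHullZetaKummerCoreInputs)
    (hCassels : bsdRHS_eq_of_isIsogenous) (hGZK : rank_eq_analyticRank_of_analyticRank_le_one)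
    (hmodL : hasEntireLFunction_rat) :
    Summit.BirchSwinnertonDyer.BirchSwinnertonDyer.Theses.KatoDescentPotSupersingular.WildUpperReducibleDefect :=
  wildUpperReducibleDefect_of_coreInputs hne hmod
    (MemberHullZetaCoreInputsOfKummer.exists_memberHullZetaCoreInputs_of_kummerCoreInputs hin) hCassels hGZK hmodL

/-- **The K8-t′ item from the PRINT-EXACT (Kummer-form) package.** [cite: Kato2004Asterisque, Prop. 14.16 (2) (p. 244) and Lemma 14.18 (pp. 247–248)] -/
theorem tameUpperReducibleDefect_of_kummerCoreInputs (hne : Kato2004.nonempty_iwasawaH1Data)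
    (hmod : exists_isNewformOf) (hin : Kato2004.exists_memberHullZetaKummerCoreInputs)
    (hCassels : bsdRHS_eq_of_isIsogenous) (hGZK : rank_eq_analyticRank_of_analyticRank_le_one)
    (hmodL : hasEntireLFunction_rat) :
    Summit.BirchSwinnertonDyer.BirchSwinnertonDyer.Theses.KatoDescentTamePotSupersingular.TameUpperReducibleDefect :=
  tameUpperReducibleDefect_of_coreInputs hne hmod
    (MemberHullZetaCoreInputsOfKummer.exists_memberHullZetaCoreInputs_of_kummerCoreInputs hin) hCassels hGZK hmodL

/-- **TYPED CLOSER OVER THE K9 ROUTE'S BY-NAME ALIASES** — the children of U₀-red 19190 with the count child 19707 REPLACED by crux M's child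
`PublishedInputMemberHullZetaCore` (27962): `PublishedInputIwasawaH1DataRed → PublishedInputNewformKatoRed → PublishedInputMemberHullZetaCore →
PublishedInputCasselsIsogenyRed → PublishedInputRankEqAnalyticRankRed → PublishedInputEntireLFunctionRed → WildUpperReducibleDefect` — the glue term of a
re-keyed split (ONE Kato input for M and U₀-red).  Conditional; closes nothing by itself.
[cite: Kato2004Asterisque, proof of Prop. 14.16 (pp. 244–245)] [cite: Cassels1965ArithmeticVIII] -/
theorem wildUpperReducibleDefectOfCoreInputs_glue :
    Summit.BirchSwinnertonDyer.BirchSwinnertonDyer.Theses.KatoDescentPotSupersingular.PublishedInputIwasawaH1DataRed →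
    Summit.BirchSwinnertonDyer.BirchSwinnertonDyer.Theses.KatoDescentPotSupersingular.PublishedInputNewformKatoRed →
    Summit.BirchSwinnertonDyer.BirchSwinnertonDyer.Theses.KatoDescentPotSupersingular.PublishedInputMemberHullZetaCore →
    Summit.BirchSwinnertonDyer.BirchSwinnertonDyer.Theses.KatoDescentPotSupersingular.PublishedInputCasselsIsogenyRed →
    Summit.BirchSwinnertonDyer.BirchSwinnertonDyer.Theses.KatoDescentPotSupersingular.PublishedInputRankEqAnalyticRankRed →
    Summit.BirchSwinnertonDyer.BirchSwinnertonDyer.Theses.KatoDescentPotSupersingular.PublishedInputEntireLFunctionRed →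
    Summit.BirchSwinnertonDyer.BirchSwinnertonDyer.Theses.KatoDescentPotSupersingular.WildUpperReducibleDefect :=
  fun hne hmod hin hC hG hL => wildUpperReducibleDefect_of_coreInputs hne hmod hin hC hG hL

/-- **TYPED CLOSER OVER THE K8-t′ ROUTE'S BY-NAME ALIASES** (children of 19203 with 19707's twin replaced by `PublishedInputMemberHullZetaCore`).
Conditional; closes nothing by itself. [cite: Kato2004Asterisque, proof of Prop. 14.16 (pp. 244–245)] [cite: Cassels1965ArithmeticVIII] -/
theorem tameUpperReducibleDefectOfCoreInputs_glue :
    Summit.BirchSwinnertonDyer.BirchSwinnertonDyer.Theses.KatoDescentTamePotSupersingular.PublishedInputIwasawaH1DataRedT →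
    Summit.BirchSwinnertonDyer.BirchSwinnertonDyer.Theses.KatoDescentTamePotSupersingular.PublishedInputNewformKatoRedT →
    Summit.BirchSwinnertonDyer.BirchSwinnertonDyer.Theses.KatoDescentTamePotSupersingular.PublishedInputMemberHullZetaCore →
    Summit.BirchSwinnertonDyer.BirchSwinnertonDyer.Theses.KatoDescentTamePotSupersingular.PublishedInputCasselsIsogenyRedT →
    Summit.BirchSwinnertonDyer.BirchSwinnertonDyer.Theses.KatoDescentTamePotSupersingular.PublishedInputRankEqAnalyticRankRedT →
    Summit.BirchSwinnertonDyer.BirchSwinnertonDyer.Theses.KatoDescentTamePotSupersingular.PublishedInputEntireLFunctionRedT →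
    Summit.BirchSwinnertonDyer.BirchSwinnertonDyer.Theses.KatoDescentTamePotSupersingular.TameUpperReducibleDefect :=
  fun hne hmod hin hC hG hL => tameUpperReducibleDefect_of_coreInputs hne hmod hin hC hG hL

end Summit.BirchSwinnertonDyer.BirchSwinnertonDyer.Theorems.ReducibleUpperOfCoreInputs

end
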